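import Literature.NumberTheory.LFunctions.PrimitiveQuadraticCharacterKroneckerEven
import HarnessLib

/-!
# The values of a primitive quadratic Dirichlet character at ALL primes from its discriminant
# `D = χ(−1) q` (including the prime `2`)

Topic `Literature/NumberTheory/LFunctions`, namespace
`Literature.NumberTheory.LFunctions.PrimitiveQuadratic` (continuing
`PrimitiveQuadraticCharacterKronecker{,Even}.lean`). Everything here is PROVED (theorems only, no
definitions, no named facts).

The companion files give `χ(n) = (D/n)` (Jacobi symbol) at ODD arguments `n`, `D = χ(−1) q`, and
the value `χ(2)` for ODD characters of odd modulus. A certificate indexed by fundamental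
discriminants (a no-exceptional-zero table row: a prime sum `∑_{p ≤ N} f(p, χ(p))`) needs `χ(p)`
at EVERY prime `p` as a function of `D` alone. This file closes the dictionary:

* `apply_prime_eq_legendreSym_sign_mul` — odd primes `p`: `χ(p) = (D/p)` (Legendre symbol), both
  parities;
* `apply_two_eq_one_of_even`, `apply_two_eq_neg_one_of_even` — **the value at `2` for EVEN
  characters of odd modulus** (`q ≡ 1 (mod 4)` squarefree): `χ(2) = (2/q) = 1` if `q ≡ 1 (mod 8)`,
  `−1` if `q ≡ 5 (mod 8)`;
* `sign_mul_mod_eight`, `apply_two_eq_ite_sign_mul` — both parities at once for odd `q > 1`: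
  `D = χ(−1) q ≡ 1 or 5 (mod 8)` and `χ(2) = 1` if `D ≡ 1 (mod 8)`, `χ(2) = −1` otherwise — the
  Kronecker symbol `(D/2) = (−1)^{(D²−1)/8}`; for even `q`, `χ(2) = 0` (`apply_two_of_even`,
  companion file).

## References

* [MontgomeryVaughan2007] H. L. Montgomery, R. C. Vaughan, *Multiplicative Number Theory I*, CUP
  2007, §9.3, Theorem 9.13.
* [Cox2013] D. A. Cox, *Primes of the form x² + ny²*, 2nd ed., Wiley 2013, §1.C, Lemma 1.14 (the
  supplement `(2/D)`).
-/

noncomputable section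

open DirichletCharacter Finset
open scoped NumberTheorySymbols

namespace Literature.NumberTheory.LFunctions.PrimitiveQuadratic

/-! ### Odd primes -/

/-- **At an odd prime `p`: `χ(p) = (D/p)`**, `D = χ(−1) q` (`s = χ(−1) = ±1` given as an integer),
for `χ` primitive quadratic mod `q` — both parities (Legendre symbol; `= 0` when `p ∣ q`).
[cite: MontgomeryVaughan2007, Theorem 9.13] -/
theorem apply_prime_eq_legendreSym_sign_mul {q : ℕ} [NeZero q] {χ : DirichletCharacter ℂ q}
    (hprim : χ.IsPrimitive) (hquad : χ.IsQuadratic) {s : ℤ} (hs : χ (-1) = (s : ℂ))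
    (hs1 : s = 1 ∨ s = -1) (p : ℕ) [Fact p.Prime] (hp2 : p ≠ 2) :
    χ (p : ZMod q) = (legendreSym p (s * q) : ℂ) := by
  rw [apply_natCast_eq_jacobiSym_sign_mul hprim hquad hs hs1
    ((Fact.out : p.Prime).odd_of_ne_two hp2), jacobiSym.legendreSym.to_jacobiSym]

/-! ### The value at `2`, even characters -/

/-- For odd `q > 1` and `χ` primitive quadratic EVEN mod `q` (so `q ≡ 1 (mod 4)` is squarefree and
`χ = (·/q)`): `χ(2) = 1` when `q ≡ 1 (mod 8)`. [cite: Cox2013, §1.C Lemma 1.14]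
[cite: MontgomeryVaughan2007, Theorem 9.13] -/
theorem apply_two_eq_one_of_even {q : ℕ} [NeZero q] (hq : Odd q) (h1 : 1 < q)
    {χ : DirichletCharacter ℂ q} (hprim : χ.IsPrimitive) (hquad : χ.IsQuadratic) (heven : χ.Even)
    (h8 : (q : ℤ) % 8 = 1) : χ (2 : ZMod q) = 1 := by
  have hsq := squarefree_of_isPrimitive_of_isQuadratic hq hprim hquad
  have hq4 := mod_four_eq_one_of_even hq h1 hprim hquad heven
  have hD4 : (q : ℤ) % 4 = 1 := by omega
  have h := apply_natCast_eq_jacobiSym hq hsq χ hprim hquad 2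
  rw [Nat.cast_ofNat] at h
  rw [h]
  have := (Literature.NumberTheory.QuadraticFields.jacobiSym_two_natAbs_eq_one_iff hD4).mpr h8
  rw [Int.natAbs_natCast] at this
  rw [Nat.cast_ofNat, this, Int.cast_one]

/-- For odd `q > 1` and `χ` primitive quadratic EVEN mod `q`: `χ(2) = −1` when `q ≡ 5 (mod 8)`.
[cite: Cox2013, §1.C Lemma 1.14] [cite: MontgomeryVaughan2007, Theorem 9.13] -/
theorem apply_two_eq_neg_one_of_even {q : ℕ} [NeZero q] (hq : Odd q) (h1 : 1 < q)
    {χ : DirichletCharacter ℂ q} (hprim : χ.IsPrimitive) (hquad : χ.IsQuadratic) (heven : χ.Even)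
    (h8 : (q : ℤ) % 8 = 5) : χ (2 : ZMod q) = -1 := by
  have hsq := squarefree_of_isPrimitive_of_isQuadratic hq hprim hquad
  have hq4 := mod_four_eq_one_of_even hq h1 hprim hquad heven
  have hD4 : (q : ℤ) % 4 = 1 := by omega
  have h := apply_natCast_eq_jacobiSym hq hsq χ hprim hquad 2
  rw [Nat.cast_ofNat] at h
  rw [h]
  have := (Literature.NumberTheory.QuadraticFields.jacobiSym_two_natAbs_eq_neg_one_iff hD4).mpr h8
  rw [Int.natAbs_natCast] at this
  rw [Nat.cast_ofNat, this, Int.cast_neg, Int.cast_one]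

/-! ### The value at `2`, both parities -/

/-- For odd `q > 1` carrying a primitive quadratic character `χ`, the discriminant `D = χ(−1) q`
satisfies `D ≡ 1 (mod 8)` or `D ≡ 5 (mod 8)` (`q ≡ 1 (mod 4)` if `χ` is even, `q ≡ 3 (mod 4)` if
`χ` is odd). [cite: MontgomeryVaughan2007, Theorem 9.13] -/
theorem sign_mul_mod_eight {q : ℕ} [NeZero q] (hq : Odd q) (h1 : 1 < q)
    {χ : DirichletCharacter ℂ q} (hprim : χ.IsPrimitive) (hquad : χ.IsQuadratic) {s : ℤ}
    (hs : χ (-1) = (s : ℂ)) (hs1 : s = 1 ∨ s = -1) :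
    (s * q : ℤ) % 8 = 1 ∨ (s * q : ℤ) % 8 = 5 := by
  rcases hs1 with rfl | rfl
  · have heven : χ.Even := by
      have h := hs
      rw [Int.cast_one] at h
      exact h
    have hq4 := mod_four_eq_one_of_even hq h1 hprim hquad heven
    omega
  · have hodd : χ.Odd := by
      have h := hs
      rw [Int.cast_neg, Int.cast_one] at h
      exact h
    have hq4 := mod_four_eq_three_of_odd hq hprim hquad hodd
    omega

/-- **The value at `2` from the discriminant, both parities**: for odd `q > 1`, `χ` primitive
quadratic mod `q` and `D = χ(−1) q` (`s = χ(−1) = ±1` as an integer): `χ(2) = 1` if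
`D ≡ 1 (mod 8)` and `χ(2) = −1` otherwise (then `D ≡ 5 (mod 8)`) — the Kronecker symbol `(D/2)`.
(For even `q`, `χ(2) = 0`: `apply_two_of_even`.) [cite: Cox2013, §1.C Lemma 1.14]
[cite: MontgomeryVaughan2007, Theorem 9.13] -/
theorem apply_two_eq_ite_sign_mul {q : ℕ} [NeZero q] (hq : Odd q) (h1 : 1 < q)
    {χ : DirichletCharacter ℂ q} (hprim : χ.IsPrimitive) (hquad : χ.IsQuadratic) {s : ℤ}
    (hs : χ (-1) = (s : ℂ)) (hs1 : s = 1 ∨ s = -1) :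
    χ (2 : ZMod q) = if (s * q : ℤ) % 8 = 1 then 1 else -1 := by
  have h15 := sign_mul_mod_eight hq h1 hprim hquad hs hs1
  rcases hs1 with rfl | rfl
  · have heven : χ.Even := by
      have h := hs
      rw [Int.cast_one] at h
      exact h
    rw [one_mul] at h15 ⊢
    rcases h15 with h | h
    · rw [if_pos h, apply_two_eq_one_of_even hq h1 hprim hquad heven h]
    · rw [if_neg (by omega), apply_two_eq_neg_one_of_even hq h1 hprim hquad heven h]
  · have hodd : χ.Odd := by
      have h := hs
      rw [Int.cast_neg, Int.cast_one] at h
      exact h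
    rw [neg_one_mul] at h15 ⊢
    rcases h15 with h | h
    · rw [if_pos h, apply_two_eq_one_of_odd hq hprim hquad hodd h]
    · rw [if_neg (by omega), apply_two_eq_neg_one_of_odd hq hprim hquad hodd h]

/-- **All primes at once** (odd modulus): for odd `q > 1`, `χ` primitive quadratic mod `q`,
`D = χ(−1) q` and any prime `p`: `χ(p) = (D/2)` (the mod-8 rule) if `p = 2`, and `χ(p) = (D/p)`
(Legendre symbol) if `p` is odd. [cite: MontgomeryVaughan2007, Theorem 9.13] -/
theorem apply_prime_eq_of_odd_level {q : ℕ} [NeZero q] (hq : Odd q) (h1 : 1 < q)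
    {χ : DirichletCharacter ℂ q} (hprim : χ.IsPrimitive) (hquad : χ.IsQuadratic) {s : ℤ}
    (hs : χ (-1) = (s : ℂ)) (hs1 : s = 1 ∨ s = -1) (p : ℕ) [Fact p.Prime] :
    χ (p : ZMod q) =
      if p = 2 then (if (s * q : ℤ) % 8 = 1 then 1 else -1) else (legendreSym p (s * q) : ℂ) := by
  by_cases hp2 : p = 2
  · subst hp2
    rw [if_pos rfl, Nat.cast_ofNat, apply_two_eq_ite_sign_mul hq h1 hprim hquad hs hs1]
  · rw [if_neg hp2, apply_prime_eq_legendreSym_sign_mul hprim hquad hs hs1 p hp2]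

end Literature.NumberTheory.LFunctions.PrimitiveQuadratic

end
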